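import Summits.CriticalPhenomena.PercolationContinuityZ3.Theorems.FK.SprinklingCouplingFK
import Summits.CriticalPhenomena.PercolationContinuityZ3.Theorems.FK.SteepnessFK
import Mathlib.Analysis.SpecialFunctions.Pow.Real
import HarnessLib

/-!
# Sprinkling for the random-cluster measure, 3/3 — **Theorem (3.45)** (Grimmett 2006; Grimmett–Piza):
# `φ_{r,q}(H_A ≤ k) ≤ C^k φ_{s,q}(A)`, `q ≥ 1`, `0 < r < s < 1`, and its consequence (3.47)

Claimed R42 (8)(c) in the cell INBOX at 2026-08-27T11:05:32Z by fkp-10a gen 349 under provision (ι) (no coordinator fk-4 seated after g251 closed l.8021 2026-08-27T10:12Z; the lane lead absorbs the registry word; silence = consent; a seated coordinator’s word would govern); lineage row FO-10a-g349 (self-suggested), package g349-steepness, label ST-F.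
Support file of the `fk-continuity` cell (lineage fkp-10a, `--supports stmt-CriticalPhenomena-4575`); builds on
p205010 (kernel theorem, internal audit signed; external expert review pending).  No definitions, no named facts,
no sorries; standard axioms.  UNCONDITIONAL finite-graph random-cluster theory (`q ≥ 1`).

Grimmett 2006, §3.5, **Theorem (3.45)**: for `q ≥ 1`, `0 < r < s < 1` and a non-empty increasing event `A`,
`φ_{r,q}(H_A ≤ k) ≤ C^k φ_{s,q}(A)` for every `k`, with `C = q²(1-r)/((s-r)(r+q(1-r)))` — opening `k` further
edges is paid for by raising the edge density from `r` to `s`, WITHOUT an entropy factor for the choice of the edges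
(the random-cluster version of the sprinkling lemma; the Literature has only the Bernoulli version,
`Percolation/StaticRenormalizationSprinkling.lean`).  Stated for the tree's `rcMeasure G p q B` with ANY wired set
`B`, and `{H_A^F ≤ k} = Steepness.withinDist F A k` for an event determined by `F ⊆ E(G)`.  Proof: sum the
finite-energy property (3.54) of the coupling of `SprinklingCouplingFK.lean` over the configurations `ξ` with
`H_A(ξ) ≤ k` and a chosen `D_ξ`, `|D_ξ| ≤ k`, `ξ ∪ D_ξ ∈ A`.  Consequence **(3.47)**:
`φ_{r,q}(H_A^F) ≥ Σ_{k<K} (1 - C^k φ_{s,q}(A))` for EVERY `K` (for `k ≥ |F|` the summand is `≤ 0`, as (3.46) with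
`k = |F|` forces `C^{|F|} φ_s(A) ≥ 1`), whence the printed form
`φ_{r,q}(H_A^F) ≥ -log φ_{s,q}(A)/log C - (C - φ_{s,q}(A))/(C-1)`.

## Contents (namespace `Summit.CriticalPhenomena.PercolationContinuityZ3.Theorems.FK`)

* `rcMeasure_real_cyl_edgeFinset`, `rcMeasure_real_eq_sum_cyl` (cylinders over the whole edge set);
* **`rcMeasure_real_withinDist_le_pow_mul`** (Theorem (3.45), eq. (3.46), as `c^k φ_r(H_A ≤ k) ≤ φ_s(A)`, `c = 1/C`);
* **`sum_one_sub_pow_mul_le_meanHamDist`** ((3.47), finite-sum form, every `K`),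
  **`neg_log_div_log_sub_le_meanHamDist`** ((3.47) as printed).

## References

* G. Grimmett, *The Random-Cluster Model*, Springer 2006: §3.5 Thm. (3.45), (3.46)–(3.47), pp. 53–55.
  [Grimmett2006]
* G. R. Grimmett, M. S. T. Piza, Comm. Math. Phys. 189 (1997) 465–480 (Grimmett's [163]). [GrimmettPiza1997]
* G. Grimmett, *Percolation*, 2nd ed., Springer 1999, §2.6 Thm. (2.45) (sprinkling). [GrimmettPercolation1999]
-/

noncomputable section

open scoped Classical
open MeasureTheory Finset

namespace Summit.CriticalPhenomena.PercolationContinuityZ3.Theorems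

namespace FK

open Literature.Probability.LatticeModels Literature.Probability.Percolation
  Literature.Probability.Percolation.Steepness

section FiniteGraph

variable {V : Type*} [Fintype V] [DecidableEq V] (G : SimpleGraph V) [DecidableRel G.Adj]

/-! ### Cylinders over the whole edge set -/

/-- For `π ⊆ E(G)`: `φ^B_{G,p,q}(ω ∩ E(G) = π) = w(π)/Z`. [cite: Grimmett2006, §1.2 eq. (1.2)] -/
theorem rcMeasure_real_cyl_edgeFinset {p q : ℝ} (hp : p ∈ Set.Icc (0 : ℝ) 1) (hq : 0 < q) (B : Set V)
    {π : Finset (Sym2 V)} (hπ : π ⊆ G.edgeFinset) :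
    (rcMeasure G p q B).real {ν : BondConfig V | ν ∩ ↑G.edgeFinset = ↑π} =
      rcWeight G p q B π / rcPartitionFunction G p q B := by
  rw [rcMeasure_real_apply G hp hq B]
  have h : ∀ ω ∈ G.edgeFinset.powerset,
      (if (↑ω : BondConfig V) ∈ {ν : BondConfig V | ν ∩ ↑G.edgeFinset = ↑π}
        then rcWeight G p q B ω / rcPartitionFunction G p q B else 0) =
      if ω = π then rcWeight G p q B ω / rcPartitionFunction G p q B else 0 := by
    intro ω hω
    have hωE : ω ⊆ G.edgeFinset := Finset.mem_powerset.1 hω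
    have : ((↑ω : BondConfig V) ∈ {ν : BondConfig V | ν ∩ ↑G.edgeFinset = ↑π}) ↔ ω = π := by
      simp only [Set.mem_setOf_eq]
      rw [Set.inter_eq_left.2 (Finset.coe_subset.2 hωE), Finset.coe_inj]
    simp only [this]
  rw [Finset.sum_congr rfl h, Finset.sum_ite_eq' G.edgeFinset.powerset π, if_pos (Finset.mem_powerset.2 hπ)]

/-- `φ^B_{G,p,q}(X) = Σ_{π ⊆ E(G), π ∈ X} φ(ω ∩ E(G) = π)`. [cite: Grimmett2006, §1.2 eq. (1.2)] -/
theorem rcMeasure_real_eq_sum_cyl {p q : ℝ} (hp : p ∈ Set.Icc (0 : ℝ) 1) (hq : 0 < q) (B : Set V)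
    (X : Set (BondConfig V)) :
    (rcMeasure G p q B).real X = ∑ π ∈ G.edgeFinset.powerset,
      if (↑π : BondConfig V) ∈ X then (rcMeasure G p q B).real {ν : BondConfig V | ν ∩ ↑G.edgeFinset = ↑π}
        else 0 := by
  rw [rcMeasure_real_apply G hp hq B X]
  refine Finset.sum_congr rfl fun π hπ => ?_
  rw [rcMeasure_real_cyl_edgeFinset G hp hq B (Finset.mem_powerset.1 hπ)]

/-! ### Theorem (3.45) -/

/-- **Theorem (3.45) (Grimmett 2006; Grimmett–Piza): sprinkling for the random-cluster measure.**  For `q ≥ 1`,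
any wired set `B`, `0 < r ≤ s < 1`, an increasing event `A` determined by a finite `F ⊆ E(G)`, and every `k`:
`φ^B_{G,r,q}(H_A^F ≤ k) ≤ C^k · φ^B_{G,s,q}(A)`, `C = q²(1-r)/((s-r)(r+q(1-r)))`, written as
`c^k φ_r(withinDist F A k) ≤ φ_s(A)` with `c = 1/C = ((s-r)/q)·(r+q(1-r))/(q(1-r))`.
[cite: Grimmett2006, Thm. (3.45) eq. (3.46)] -/
theorem rcMeasure_real_withinDist_le_pow_mul {q : ℝ} (hq : 1 ≤ q) (B : Set V) {F : Finset (Sym2 V)}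
    (hF : (↑F : Set (Sym2 V)) ⊆ G.edgeSet) {A : Set (BondConfig V)} (hA : IsUpperSet A) {r s : ℝ} (hr : 0 < r)
    (hrs : r ≤ s) (hs : s < 1) (k : ℕ) :
    ((s - r) / q * ((r + q * (1 - r)) / (q * (1 - r)))) ^ k * (rcMeasure G r q B).real (withinDist F A k) ≤
      (rcMeasure G s q B).real A := by
  have hq0 : 0 < q := one_pos.trans_le hq
  have hrI : r ∈ Set.Icc (0 : ℝ) 1 := ⟨hr.le, hrs.trans hs.le⟩
  have hsI : s ∈ Set.Icc (0 : ℝ) 1 := ⟨hr.le.trans hrs, hs.le⟩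
  set c : ℝ := (s - r) / q * ((r + q * (1 - r)) / (q * (1 - r))) with hc
  have h1r : 0 < 1 - r := by linarith
  have hd : 0 < r + q * (1 - r) := by positivity
  have hc0 : 0 ≤ c := by positivity
  have hc1 : c ≤ 1 := by
    -- `c ≤ (1-r)(r+q(1-r))/(q²(1-r)) = (r+q(1-r))/q² ≤ q/q² ≤ 1`
    rw [hc, div_mul_div_comm, div_le_one (by positivity)]
    have h1 : s - r ≤ 1 - r := by linarith
    have h2 : r + q * (1 - r) ≤ q := by nlinarith
    calc (s - r) * (r + q * (1 - r)) ≤ (1 - r) * q := mul_le_mul h1 h2 hd.le h1r.le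
      _ ≤ q * (q * (1 - r)) := by nlinarith [mul_nonneg (sub_nonneg.2 hq) (mul_nonneg hq0.le h1r.le)]
  have hFE : F ⊆ G.edgeFinset := fun f hf => by simpa using hF hf
  obtain ⟨κ, h0, hsupp, hmr, hms, hD⟩ := exists_sprinklingCoupling G hq B hr hrs hs (Finset.Subset.refl G.edgeFinset)
  -- choose, for each `π` with `H_A(π) ≤ k`, a set `D π ⊆ F ∖ π` with `|D π| ≤ k` and `π ∪ D π ∈ A`
  have hchoice : ∀ π : Finset (Sym2 V), ∃ D : Finset (Sym2 V), ((↑π : BondConfig V) ∈ withinDist F A k →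
      D ⊆ F ∧ D.card ≤ k ∧ Disjoint D π ∧ (↑(π ∪ D) : BondConfig V) ∈ A) := by
    intro π
    by_cases h : (↑π : BondConfig V) ∈ withinDist F A k
    · obtain ⟨S, hSF, hSk, hS⟩ := h
      refine ⟨S \ π, fun _ => ⟨Finset.sdiff_subset.trans hSF, (Finset.card_le_card Finset.sdiff_subset).trans hSk,
        Finset.sdiff_disjoint, ?_⟩⟩
      · have : (↑(π ∪ S \ π) : BondConfig V) = ↑π ∪ ↑S := by
          rw [Finset.union_sdiff_self_eq_union, Finset.coe_union]
        rw [this]; exact hS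
    · exact ⟨∅, fun h' => absurd h' h⟩
  choose D hDspec using hchoice
  -- sum (3.54) over these `π`
  have hlow : c ^ k * (rcMeasure G r q B).real (withinDist F A k) ≤
      ∑ π ∈ G.edgeFinset.powerset, if (↑π : BondConfig V) ∈ withinDist F A k then
        ∑ ω : Finset (Sym2 V), (if D π ⊆ ω then κ π ω else 0) else 0 := by
    rw [rcMeasure_real_eq_sum_cyl G hrI hq0 B, Finset.mul_sum]
    refine Finset.sum_le_sum fun π hπ => ?_
    have hπE : π ⊆ G.edgeFinset := Finset.mem_powerset.1 hπ
    split_ifs with hW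
    · obtain ⟨hDF, hDk, hDdisj, -⟩ := hDspec π hW
      refine le_trans ?_ (hD π (D π) hπE (hDF.trans hFE) hDdisj)
      refine mul_le_mul_of_nonneg_right (pow_le_pow_of_le_one hc0 hc1 hDk) measureReal_nonneg
    · simp
  -- and bound the double sum by the second marginal on `A`
  have hupp : ∑ π ∈ G.edgeFinset.powerset, (if (↑π : BondConfig V) ∈ withinDist F A k then
        ∑ ω : Finset (Sym2 V), (if D π ⊆ ω then κ π ω else 0) else 0) ≤
      ∑ π ∈ G.edgeFinset.powerset, ∑ ω : Finset (Sym2 V), (if (↑ω : BondConfig V) ∈ A then κ π ω else 0) := by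
    refine Finset.sum_le_sum fun π hπ => ?_
    split_ifs with hW
    · refine Finset.sum_le_sum fun ω _ => ?_
      by_cases hk0 : κ π ω = 0
      · simp [hk0]
      split_ifs with h1 h2 h2
      · exact le_rfl
      · exfalso
        obtain ⟨-, -, -, hmem⟩ := hDspec π hW
        have hsub : π ∪ D π ⊆ ω := Finset.union_subset (hsupp π ω hk0).1 h1
        exact h2 (hA (Finset.coe_subset.2 hsub) hmem)
      · exact h0 π ω
      · exact le_rfl
    · exact Finset.sum_nonneg fun ω _ => by split_ifs <;> [exact h0 π ω; exact le_rfl]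
  have hsum : ∑ π ∈ G.edgeFinset.powerset, ∑ ω : Finset (Sym2 V), (if (↑ω : BondConfig V) ∈ A then κ π ω else 0) =
      (rcMeasure G s q B).real A := by
    -- extend the outer sum to all `π` (support), swap, use the second marginal
    have hext : ∑ π ∈ G.edgeFinset.powerset, ∑ ω : Finset (Sym2 V), (if (↑ω : BondConfig V) ∈ A then κ π ω else 0) =
        ∑ π : Finset (Sym2 V), ∑ ω : Finset (Sym2 V), (if (↑ω : BondConfig V) ∈ A then κ π ω else 0) := by
      refine Finset.sum_subset (Finset.subset_univ _) fun π _ hπ => ?_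
      refine Finset.sum_eq_zero fun ω _ => ?_
      split_ifs
      · by_contra hk
        obtain ⟨h1, h2⟩ := hsupp π ω hk
        exact hπ (Finset.mem_powerset.2 (h1.trans h2))
      · rfl
    rw [hext, Finset.sum_comm, rcMeasure_real_eq_sum_cyl G hsI hq0 B A]
    have hext' : ∑ ω ∈ G.edgeFinset.powerset, (if (↑ω : BondConfig V) ∈ A then
        (rcMeasure G s q B).real {ν : BondConfig V | ν ∩ ↑G.edgeFinset = ↑ω} else 0) =
        ∑ ω : Finset (Sym2 V), (if (↑ω : BondConfig V) ∈ A then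
          (rcMeasure G s q B).real {ν : BondConfig V | ν ∩ ↑G.edgeFinset = ↑ω} else 0) := by
      refine Finset.sum_subset (Finset.subset_univ _) fun ω _ hω => ?_
      -- `ω ⊄ E(G)`: the cylinder is empty of edge sets of `G`
      split_ifs
      · rw [rcMeasure_real_apply G hsI hq0 B]
        refine Finset.sum_eq_zero fun η hη => ?_
        rw [if_neg]
        intro hmem
        simp only [Set.mem_setOf_eq] at hmem
        rw [Set.inter_eq_left.2 (Finset.coe_subset.2 (Finset.mem_powerset.1 hη)), Finset.coe_inj] at hmem
        exact hω (hmem ▸ hη)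
      · rfl
    rw [hext']
    refine Finset.sum_congr rfl fun ω _ => ?_
    split_ifs with hωA
    · by_cases hωE : ω ⊆ G.edgeFinset
      · exact hms ω hωE
      · -- both sides vanish
        have hl : ∑ π, κ π ω = 0 := Finset.sum_eq_zero fun π _ => by
          by_contra hk
          exact hωE (hsupp π ω hk).2
        rw [hl, rcMeasure_real_apply G hsI hq0 B]
        refine (Finset.sum_eq_zero fun η hη => ?_).symm
        rw [if_neg]
        intro hmem
        simp only [Set.mem_setOf_eq] at hmem
        rw [Set.inter_eq_left.2 (Finset.coe_subset.2 (Finset.mem_powerset.1 hη)), Finset.coe_inj] at hmem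
        exact hωE (hmem ▸ Finset.mem_powerset.1 hη)
    · exact Finset.sum_const_zero
  linarith [hlow, hupp, hsum]

/-! ### (3.47): the mean Hamming distance is large when `φ_s(A)` is small -/

/-- **(3.47), finite-sum form**: for `q ≥ 1`, `0 < r ≤ s < 1`, a non-empty increasing `A` determined by a finite
`F ⊆ E(G)`, and EVERY `K`:  `φ_{r,q}(H_A^F) = Σ_{k<|F|} (1 - φ_{r,q}(H_A ≤ k)) ≥ Σ_{k<K} (1 - C^k φ_{s,q}(A))`
with `C = q²(1-r)/((s-r)(r+q(1-r)))` (from (3.46); for `k ≥ |F|` the summand `1 - C^k φ_s(A)` is `≤ 0` because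
(3.46) with `k = |F|` gives `C^{|F|} φ_s(A) ≥ 1`). [cite: Grimmett2006, Thm. (3.45), derivation of (3.47) p. 54] -/
theorem sum_one_sub_pow_mul_le_meanHamDist {q : ℝ} (hq : 1 ≤ q) (B : Set V) {F : Finset (Sym2 V)}
    (hF : (↑F : Set (Sym2 V)) ⊆ G.edgeSet) {A : Set (BondConfig V)} (hA : IsUpperSet A)
    (hAF : DeterminedBy A (↑F : Set (Sym2 V))) (hne : A.Nonempty) {r s : ℝ} (hr : 0 < r) (hrs : r < s)
    (hs : s < 1) (K : ℕ) :
    ∑ k ∈ Finset.range K,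
        (1 - ((q * (q * (1 - r))) / ((s - r) * (r + q * (1 - r)))) ^ k * (rcMeasure G s q B).real A) ≤
      ∑ k ∈ Finset.range F.card, (1 - (rcMeasure G r q B).real (withinDist F A k)) := by
  have hq0 : 0 < q := one_pos.trans_le hq
  have hrI : r ∈ Set.Icc (0 : ℝ) 1 := ⟨hr.le, hrs.le.trans hs.le⟩
  haveI := isProbabilityMeasure_rcMeasure G hrI hq0 B
  set c : ℝ := (s - r) / q * ((r + q * (1 - r)) / (q * (1 - r))) with hc
  set C : ℝ := (q * (q * (1 - r))) / ((s - r) * (r + q * (1 - r))) with hC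
  have h1r : 0 < 1 - r := by linarith
  have hd : 0 < r + q * (1 - r) := by positivity
  have hsr : 0 < s - r := by linarith
  have hc0 : 0 < c := by positivity
  have hCc : C = c⁻¹ := by rw [hc, hC]; field_simp
  have hC1 : 1 ≤ C := by
    rw [hC, le_div_iff₀ (by positivity), one_mul]
    have h1 : s - r ≤ 1 - r := by linarith
    have h2 : r + q * (1 - r) ≤ q := by nlinarith
    calc (s - r) * (r + q * (1 - r)) ≤ (1 - r) * q := mul_le_mul h1 h2 hd.le h1r.le
      _ ≤ q * (q * (1 - r)) := by nlinarith [mul_nonneg (sub_nonneg.2 hq) (mul_nonneg hq0.le h1r.le)]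
  -- termwise from (3.46): `1 - C^k φ_s(A) ≤ 1 - φ_r(W_k)`
  have hterm : ∀ k, 1 - C ^ k * (rcMeasure G s q B).real A ≤ 1 - (rcMeasure G r q B).real (withinDist F A k) := by
    intro k
    have h := rcMeasure_real_withinDist_le_pow_mul G hq B hF hA hr hrs.le hs k
    have : (rcMeasure G r q B).real (withinDist F A k) ≤ C ^ k * (rcMeasure G s q B).real A := by
      rw [hCc, inv_pow, ← div_eq_inv_mul, le_div_iff₀ (pow_pos hc0 k), mul_comm]
      exact h
    linarith
  -- for `k ≥ |F|` the left summand is `≤ 0` (as `φ_r(W_{|F|}) = 1`)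
  have hneg : ∀ k, F.card ≤ k → 1 - C ^ k * (rcMeasure G s q B).real A ≤ 0 := by
    intro k hk
    have h1 : (rcMeasure G r q B).real (withinDist F A F.card) = 1 := by
      have : withinDist F A F.card = Set.univ :=
        Set.eq_univ_of_forall fun ω => mem_withinDist_card hA hAF hne ω
      rw [this, probReal_univ]
    have h2 := hterm F.card
    rw [h1] at h2
    have h3 : C ^ F.card * (rcMeasure G s q B).real A ≤ C ^ k * (rcMeasure G s q B).real A :=
      mul_le_mul_of_nonneg_right (pow_le_pow_right₀ hC1 hk) measureReal_nonneg
    linarith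
  -- compare the sums
  by_cases hK : K ≤ F.card
  · calc ∑ k ∈ Finset.range K, (1 - C ^ k * (rcMeasure G s q B).real A)
        ≤ ∑ k ∈ Finset.range K, (1 - (rcMeasure G r q B).real (withinDist F A k)) :=
          Finset.sum_le_sum fun k _ => hterm k
      _ ≤ ∑ k ∈ Finset.range F.card, (1 - (rcMeasure G r q B).real (withinDist F A k)) := by
          refine Finset.sum_le_sum_of_subset_of_nonneg (Finset.range_subset_range.2 hK) fun k _ _ => ?_
          linarith [measureReal_le_one (μ := rcMeasure G r q B) (s := withinDist F A k)]
  · push Not at hK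
    rw [← Finset.sum_range_add_sum_Ico _ hK.le]
    have htail : ∑ k ∈ Finset.Ico F.card K, (1 - C ^ k * (rcMeasure G s q B).real A) ≤ 0 :=
      Finset.sum_nonpos fun k hk => hneg k (Finset.mem_Ico.1 hk).1
    linarith [Finset.sum_le_sum fun k (_ : k ∈ Finset.range F.card) => hterm k]

/-- **(3.47) as printed** (Grimmett 2006): for `q ≥ 1`, `0 < r < s < 1`, a non-empty increasing `A` determined by a
finite `F ⊆ E(G)`:  `φ_{r,q}(H_A^F) ≥ -log φ_{s,q}(A)/log C - (C - φ_{s,q}(A))/(C - 1)` whenever `C > 1`,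
`C = q²(1-r)/((s-r)(r+q(1-r)))` (take `K = ⌈-log φ_s(A)/log C⌉` in the finite-sum form; `φ_s(A) > 0`).
[cite: Grimmett2006, Thm. (3.45) eq. (3.47)] -/
theorem neg_log_div_log_sub_le_meanHamDist {q : ℝ} (hq : 1 ≤ q) (B : Set V) {F : Finset (Sym2 V)}
    (hF : (↑F : Set (Sym2 V)) ⊆ G.edgeSet) {A : Set (BondConfig V)} (hA : IsUpperSet A)
    (hAF : DeterminedBy A (↑F : Set (Sym2 V))) (hne : A.Nonempty) {r s : ℝ} (hr : 0 < r) (hrs : r < s)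
    (hs : s < 1) (hC1 : 1 < (q * (q * (1 - r))) / ((s - r) * (r + q * (1 - r)))) :
    -Real.log ((rcMeasure G s q B).real A) / Real.log ((q * (q * (1 - r))) / ((s - r) * (r + q * (1 - r)))) -
        ((q * (q * (1 - r))) / ((s - r) * (r + q * (1 - r))) - (rcMeasure G s q B).real A) /
          ((q * (q * (1 - r))) / ((s - r) * (r + q * (1 - r))) - 1) ≤
      ∑ k ∈ Finset.range F.card, (1 - (rcMeasure G r q B).real (withinDist F A k)) := by
  have hq0 : 0 < q := one_pos.trans_le hq
  set C : ℝ := (q * (q * (1 - r))) / ((s - r) * (r + q * (1 - r))) with hC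
  set θ : ℝ := (rcMeasure G s q B).real A with hθ
  have hθ0 : 0 < θ := rcMeasure_real_pos_of_nonempty G ⟨hr.trans hrs, hs⟩ hq0 B hF hA hAF hne
  have hlogC : 0 < Real.log C := Real.log_pos hC1
  -- `K = ⌈-log θ / log C⌉`
  set K : ℕ := ⌈-Real.log θ / Real.log C⌉₊ with hK
  have hmain := sum_one_sub_pow_mul_le_meanHamDist G hq B hF hA hAF hne hr hrs hs K
  refine le_trans ?_ hmain
  -- `Σ_{k<K} (1 - C^k θ) = K - θ (C^K - 1)/(C - 1)`
  have hgeom : ∑ k ∈ Finset.range K, (1 - C ^ k * θ) = K - θ * ((C ^ K - 1) / (C - 1)) := by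
    rw [Finset.sum_sub_distrib, Finset.sum_const, Finset.card_range, nsmul_eq_mul, mul_one, ← Finset.sum_mul,
      geom_sum_eq hC1.ne', mul_comm θ]
  rw [hgeom]
  -- `K ≥ -log θ/log C` and `θ C^K < C`
  have hK1 : -Real.log θ / Real.log C ≤ K := Nat.le_ceil _
  haveI := isProbabilityMeasure_rcMeasure G (show s ∈ Set.Icc (0 : ℝ) 1 from ⟨(hr.trans hrs).le, hs.le⟩) hq0 B
  have hθ1 : θ ≤ 1 := measureReal_le_one
  have hK2 : (K : ℝ) < -Real.log θ / Real.log C + 1 := Nat.ceil_lt_add_one (by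
    have : Real.log θ ≤ 0 := Real.log_nonpos hθ0.le hθ1
    exact div_nonneg (by linarith) hlogC.le)
  have hCK : θ * C ^ K < C := by
    -- `C^K = exp(K log C) < exp(-log θ + log C) = C/θ`
    have h1 : (C : ℝ) ^ K = Real.exp (K * Real.log C) := by
      rw [← Real.rpow_natCast, Real.rpow_def_of_pos (by linarith), mul_comm]
    have h2 : (K : ℝ) * Real.log C < -Real.log θ + Real.log C := by
      have := mul_lt_mul_of_pos_right hK2 hlogC
      rwa [add_mul, one_mul, div_mul_cancel₀ _ hlogC.ne'] at this
    have h3 : Real.exp (-Real.log θ + Real.log C) = C / θ := by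
      rw [Real.exp_add, Real.exp_neg, Real.exp_log hθ0, Real.exp_log (by linarith)]
      field_simp
    calc θ * C ^ K = θ * Real.exp (K * Real.log C) := by rw [h1]
      _ < θ * Real.exp (-Real.log θ + Real.log C) := mul_lt_mul_of_pos_left (Real.exp_lt_exp.2 h2) hθ0
      _ = C := by rw [h3]; field_simp
  have hC1' : 0 < C - 1 := by linarith
  have hfrac : θ * ((C ^ K - 1) / (C - 1)) ≤ (C - θ) / (C - 1) := by
    rw [mul_div_assoc', div_le_div_iff_of_pos_right hC1']
    nlinarith
  linarith

end FiniteGraph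

end FK

end Summit.CriticalPhenomena.PercolationContinuityZ3.Theorems

end
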